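import Summits.Ventures.Crystal3D.Theorems.StickyWulffConstantGenericWallFloorTwinStarPairCross
import HarnessLib

/-!
# The semantic priced class enlarged by the twin-cross pairs, and the composition `c₀ = 1`
# (crux `GenericWallFloor`, stmt-Ventures-19480, line `WallLedgerG`)

HONEST FRAMING. Venture `Summits/Ventures/Crystal3D` (cell `crystal3d-full`), helper `--supports` the crux
`GenericWallFloor` of `route-Ventures-StickyWulffConstant`, REGISTERED line `WallLedgerG`, open stub
`stub_twoSlabAdhesion`.  Rung credit + bookkeeping only; F-C1 not moved; NOT the crux: `ExactOnly`(C12-55) [E1] and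
`StarPairFar` [certified] stay BY NAME.

`…InPlaneTwinOnly` (19480-p2 g5) states the priced ledger's composition ONCE for the class `InPlaneTwinOnlyAt`: some steep
slot pair all of whose co-axial pairs of stack tops carry in-plane twin data.  `…TwinStarPairCross` (this seat) proved,
census-free, that twin pairs of tops whose direction `ν`-components do not cancel (`TwinCrossData`: mixed in-plane ×
crossing, or same-side crossing) can never share an end ball, so they are priced VACUOUSLY (`hcross_of_twinCrossData`).
This file enlarges the semantic class accordingly and repeats the composition:
* `TwinPricedOnlyAt A₁ A₂` — some steep slot pair such that every co-axial pair of tops carries `InPlaneTwinData` or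
  `TwinCrossData` (either order); `twinPricedOnlyAt_of_inPlaneTwinOnlyAt`;
* `genericWallFloorAtCharge_one_of_twinPricedOnlyAt`, `genericWallFloorAt_of_twinPricedOnlyAt` — `c₀ = 1` on the class,
  modulo `ExactOnly`(C12-55) and `StarPairFar` (the proof of `genericWallFloorAtCharge_one_of_inPlaneTwinOnlyAt` verbatim,
  with the twin-cross pairs fed to `twoSlabAdhesion_stackLedger_cross` by `hcross_of_twinCrossData`; arrivals are again
  excluded for free, `false_of_twinCrossData_of_image_eq`).
After this file the only co-axial top pairs a two-family ledger of the line cannot absorb are the EQUAL-lattice pairs and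
the opposite-side crossing twin pairs (both vacancy-type double ends).
WHAT THIS IS NOT: not the stub; no new cell is claimed here (for bottom-started chain-pair families the exits are in-plane,
`inner_dir_eq_zero_of_ray`, so the enlargement matters for restarted / lamella families); F-C1 not moved.
-/

noncomputable section

namespace Summit.Ventures.Crystal3D.Theorems

open Summit.Ventures.Crystal3D Finset
open Literature.MathematicalPhysics.StatisticalMechanics (fccStacking barlowStacking IsHaggSeq)
open scoped InnerProductSpace

/-! ### The enlarged semantic priced class and the composition -/

/-- **The enlarged priced class**: some steep up-slot `u₁` of grain 1 and steep down-slot `u₂` of grain 2 such that every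
co-axial pair of tops of sound well-formed stacks over `(A₁,u₁,0)` (vertical `e₃`) and `(A₂,u₂,0)` (vertical `−e₃`)
carries in-plane twin data (priced by `InPlaneTwinStarPair`) or twin-cross data (vacuous), in one of the two orders. -/
def TwinPricedOnlyAt (A₁ A₂ : EuclideanSpace ℝ (Fin 3) ≃ₗᵢ[ℝ] EuclideanSpace ℝ (Fin 3)) : Prop :=
  ∃ u₁ ∈ fccSlots, Real.sqrt 2 / 2 ≤ ⟪A₁ u₁, EuclideanSpace.single (2 : Fin 3) (1 : ℝ)⟫_ℝ ∧
  ∃ u₂ ∈ fccSlots, ⟪A₂ u₂, EuclideanSpace.single (2 : Fin 3) (1 : ℝ)⟫_ℝ ≤ -(Real.sqrt 2 / 2) ∧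
    ∀ (e₁ e₂ : WalkEntry) (rest₁ rest₂ : List WalkEntry),
      StackSound (EuclideanSpace.single (2 : Fin 3) (1 : ℝ)) (e₁ :: rest₁) →
      StackWF (EuclideanSpace.single (2 : Fin 3) (1 : ℝ)) (e₁ :: rest₁) → (e₁ :: rest₁).getLast? = some ⟨A₁, u₁, 0⟩ →
      StackSound (-EuclideanSpace.single (2 : Fin 3) (1 : ℝ)) (e₂ :: rest₂) →
      StackWF (-EuclideanSpace.single (2 : Fin 3) (1 : ℝ)) (e₂ :: rest₂) → (e₂ :: rest₂).getLast? = some ⟨A₂, u₂, 0⟩ →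
      (∃ (L : EuclideanSpace ℝ (Fin 3) ≃ₗᵢ[ℝ] EuclideanSpace ℝ (Fin 3))
          (s₁ s₂ : EuclideanSpace ℝ (Fin 3)) (σ σ' : ℤ → ℤ), IsHaggSeq σ ∧ IsHaggSeq σ' ∧
          e₁.frame '' fccStacking 1 (Real.sqrt (2 / 3)) ⊆ (fun p => L p + s₁) '' barlowStacking 1 (Real.sqrt (2 / 3)) σ ∧
          e₂.frame '' fccStacking 1 (Real.sqrt (2 / 3)) ⊆ (fun p => L p + s₂) '' barlowStacking 1 (Real.sqrt (2 / 3)) σ') →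
      (InPlaneTwinData e₁ e₂ ∨ InPlaneTwinData e₂ e₁) ∨ (TwinCrossData e₁ e₂ ∨ TwinCrossData e₂ e₁)

/-- The in-plane priced class lies in the enlarged one. -/
theorem twinPricedOnlyAt_of_inPlaneTwinOnlyAt {A₁ A₂ : EuclideanSpace ℝ (Fin 3) ≃ₗᵢ[ℝ] EuclideanSpace ℝ (Fin 3)}
    (h : InPlaneTwinOnlyAt A₁ A₂) : TwinPricedOnlyAt A₁ A₂ := by
  obtain ⟨u₁, hu₁, hsteep₁, u₂, hu₂, hsteep₂, htwin⟩ := h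
  exact ⟨u₁, hu₁, hsteep₁, u₂, hu₂, hsteep₂, fun e₁ e₂ rest₁ rest₂ hS₁ hW₁ hl₁ hS₂ hW₂ hl₂ hco =>
    Or.inl (htwin e₁ e₂ rest₁ rest₂ hS₁ hW₁ hl₁ hS₂ hW₂ hl₂ hco)⟩

open scoped Classical in
/-- **The composition on the enlarged priced class**: the crux's matrix at FULL charge `c₀ = 1`, modulo
`ExactOnly`(C12-55) and `StarPairFar` (the proof of `genericWallFloorAtCharge_one_of_inPlaneTwinOnlyAt` with the
twin-cross pairs fed to the ledger by `hcross_of_twinCrossData`). -/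
theorem genericWallFloorAtCharge_one_of_twinPricedOnlyAt
    {s₀ : EuclideanSpace ℝ (Fin 3)} (hs₀ : s₀ ∈ fccSlots)
    (hcert : ExactOnly 0 (fccSlots.filter fun w => 0 < ⟪w, s₀⟫_ℝ)) (hfar : StarPairFar)
    {A₁ A₂ : EuclideanSpace ℝ (Fin 3) ≃ₗᵢ[ℝ] EuclideanSpace ℝ (Fin 3)} (h : TwinPricedOnlyAt A₁ A₂)
    (t₁ t₂ : EuclideanSpace ℝ (Fin 3)) : GenericWallFloorAtCharge 1 A₁ t₁ A₂ t₂ := by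
  obtain ⟨u₁, hu₁, hsteep₁, u₂, hu₂, hsteep₂, htwin⟩ := h
  set e₃ : EuclideanSpace ℝ (Fin 3) := EuclideanSpace.single (2 : Fin 3) (1 : ℝ) with he₃
  have hsteep₂' : Real.sqrt 2 / 2 ≤ ⟪A₂ u₂, -e₃⟫_ℝ := by rw [inner_neg_right]; linarith only [hsteep₂]
  -- the trivial stacks on both sides
  have hS₀₁ : StackSound e₃ [⟨A₁, u₁, 0⟩] := ⟨hu₁, hsteep₁⟩
  have hW₀₁ : StackWF e₃ [⟨A₁, u₁, 0⟩] := rfl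
  have hS₀₂ : StackSound (-e₃) [⟨A₂, u₂, 0⟩] := ⟨hu₂, hsteep₂'⟩
  have hW₀₂ : StackWF (-e₃) [⟨A₂, u₂, 0⟩] := rfl
  have absurd_of_data : ∀ {e₁ e₂ : WalkEntry},
      (InPlaneTwinData e₁ e₂ ∨ InPlaneTwinData e₂ e₁) ∨ (TwinCrossData e₁ e₂ ∨ TwinCrossData e₂ e₁) →
      e₁.frame '' fccStacking 1 (Real.sqrt (2 / 3)) = e₂.frame '' fccStacking 1 (Real.sqrt (2 / 3)) → False :=
    fun hd hEq => hd.elim (fun h => false_of_inPlaneTwinData_of_image_eq h hEq)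
      (fun h => false_of_twinCrossData_of_image_eq h hEq)
  -- (a) no grain-1 stack frame is `A₂·Λ₀`
  have hfar₁ : ∀ stk : List WalkEntry, StackSound e₃ stk → StackWF e₃ stk → stk.getLast? = some ⟨A₁, u₁, 0⟩ →
      ∀ e ∈ stk, e.frame '' fccStacking 1 (Real.sqrt (2 / 3)) ≠ A₂ '' fccStacking 1 (Real.sqrt (2 / 3)) := by
    intro stk hS hW hl e he hEq
    obtain ⟨r, hS', hW', hl'⟩ := exists_suffix_of_mem stk e he hS hW
    rw [hl] at hl'
    have hco := coaxial_linear_of_image_eq (F₁ := e.frame) (F₂ := (⟨A₂, u₂, 0⟩ : WalkEntry).frame) hEq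
    exact absurd_of_data (htwin e ⟨A₂, u₂, 0⟩ r [] hS' hW' hl' hS₀₂ hW₀₂ rfl hco) hEq
  -- (b) no grain-2 stack frame is `A₁·Λ₀`
  have hfar₂ : ∀ stk : List WalkEntry, StackSound (-e₃) stk → StackWF (-e₃) stk → stk.getLast? = some ⟨A₂, u₂, 0⟩ →
      ∀ e ∈ stk, e.frame '' fccStacking 1 (Real.sqrt (2 / 3)) ≠ A₁ '' fccStacking 1 (Real.sqrt (2 / 3)) := by
    intro stk hS hW hl e he hEq
    obtain ⟨r, hS', hW', hl'⟩ := exists_suffix_of_mem stk e he hS hW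
    rw [hl] at hl'
    have hco := coaxial_linear_of_image_eq (F₁ := (⟨A₁, u₁, 0⟩ : WalkEntry).frame) (F₂ := e.frame) hEq.symm
    exact absurd_of_data (htwin ⟨A₁, u₁, 0⟩ e [] r hS₀₁ hW₀₁ rfl hS' hW' hl' hco) hEq.symm
  -- (c) the priced / vacuous cross pairs
  have hledger := twoSlabAdhesion_stackLedger_cross hs₀ hcert (doubleStarCoaxialAt_of_starPairFar hfar)
    (capPairCoaxial_of_starPairFar hfar) A₁ t₁ A₂ t₂ hu₁ hsteep₁ hu₂ hsteep₂ hfar₁ hfar₂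
    (fun stk₁ stk₂ e₁ e₂ rest₁ rest₂ hS₁ hW₁ hl₁ hst₁ hS₂ hW₂ hl₂ hst₂ => by
      by_cases hco : ∃ (L : EuclideanSpace ℝ (Fin 3) ≃ₗᵢ[ℝ] EuclideanSpace ℝ (Fin 3))
          (s₁ s₂ : EuclideanSpace ℝ (Fin 3)) (σ σ' : ℤ → ℤ), IsHaggSeq σ ∧ IsHaggSeq σ' ∧
          e₁.frame '' fccStacking 1 (Real.sqrt (2 / 3)) ⊆ (fun p => L p + s₁) '' barlowStacking 1 (Real.sqrt (2 / 3)) σ ∧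
          e₂.frame '' fccStacking 1 (Real.sqrt (2 / 3)) ⊆ (fun p => L p + s₂) '' barlowStacking 1 (Real.sqrt (2 / 3)) σ'
      · right
        subst hst₁; subst hst₂
        rcases htwin e₁ e₂ rest₁ rest₂ hS₁ hW₁ hl₁ hS₂ hW₂ hl₂ hco with hin | hcr
        · intro Y hY y hy hown₁ hown₂
          rcases hin with ⟨ν, hν, hmenu, himg, hd₁, hd₂⟩ | ⟨ν, hν, hmenu, himg, hd₂, hd₁⟩
          · exact ⟨starSet_ne_of_inPlaneTwin hν hmenu himg hS₁.top.1 hd₁,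
              cover_of_inPlaneTwinStarPair inPlaneTwinStarPair_holds hY hν hmenu himg hS₁.top.1 hS₂.top.1 hd₁ hd₂ hy
                hown₁ hown₂⟩
          · refine ⟨(starSet_ne_of_inPlaneTwin hν hmenu himg hS₂.top.1 hd₂ (v₂ := e₁.dir) (e := y)).symm,
              fun q hq hqd => ?_⟩
            rw [Finset.union_comm]
            exact cover_of_inPlaneTwinStarPair inPlaneTwinStarPair_holds hY hν hmenu himg hS₂.top.1 hS₁.top.1 hd₂ hd₁ hy
              hown₂ hown₁ q hq hqd
        · exact hcross_of_twinCrossData hS₁.top.1 hS₂.top.1 hcr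
      · exact Or.inl hco)
  -- (d) the skeleton composition and the charge `½(κ₁ + κ₂) ≥ 1`
  have hκ₁ := one_le_flux_of_steep (A := A₁) (u := u₁) (le_trans hsteep₁ (le_abs_self _))
  have hκ₂ : 1 ≤ Real.sqrt 2 * |⟪A₂ u₂, EuclideanSpace.single (2 : Fin 3) (1 : ℝ)⟫_ℝ| := by
    refine one_le_flux_of_steep (A := A₂) (u := u₂) ?_
    rw [abs_of_nonpos (by linarith only [hsteep₂, Real.sqrt_nonneg 2] :
      ⟪A₂ u₂, EuclideanSpace.single (2 : Fin 3) (1 : ℝ)⟫_ℝ ≤ 0)]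
    linarith only [hsteep₂]
  exact genericWallFloorAtCharge_mono (by linarith only [hκ₁, hκ₂])
    (genericWallFloorAtCharge_of_ledger _ A₁ t₁ A₂ t₂ hledger)

/-- `GenericWallFloorAt` (the route decl's matrix) on the enlarged priced class, modulo `ExactOnly`(C12-55), `StarPairFar`. -/
theorem genericWallFloorAt_of_twinPricedOnlyAt
    {s₀ : EuclideanSpace ℝ (Fin 3)} (hs₀ : s₀ ∈ fccSlots)
    (hcert : ExactOnly 0 (fccSlots.filter fun w => 0 < ⟪w, s₀⟫_ℝ)) (hfar : StarPairFar)
    {A₁ A₂ : EuclideanSpace ℝ (Fin 3) ≃ₗᵢ[ℝ] EuclideanSpace ℝ (Fin 3)} (h : TwinPricedOnlyAt A₁ A₂)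
    (t₁ t₂ : EuclideanSpace ℝ (Fin 3)) : GenericWallFloorAt A₁ t₁ A₂ t₂ :=
  genericWallFloorAt_of_charge_one (genericWallFloorAtCharge_one_of_twinPricedOnlyAt hs₀ hcert hfar h t₁ t₂)

end Summit.Ventures.Crystal3D.Theorems

end
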